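import Mathlib.Algebra.Star.Basic
import Mathlib.NumberTheory.Zsqrtd.Basic
import Mathlib.Tactic.Ring
import Mathlib.Tactic.LinearCombination
import HarnessLib

/-!
# Venture HSemireg — the EXPLICIT PAIR TRANSPORT MATRIX of PROBE5 §19 («CONSTRUCTION (pairs, any h)» behind THEOREM REAL-PAIRS «⟸»):
# from a «unit vector» `v = (p, q)` with `c₆·N(p) + c₅·N(q) = c₅c₆` and a generator `β` with `β β̄ = c₅c₆`, the second column
# `w = (c₅ q̄ ∕ β̄, −c₆ p̄ ∕ β̄)` makes `P = [v w]` D-unitary (`P*·diag(1∕c₅, 1∕c₆)·P = 1`) with `det P = −β` — kernel algebra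

HONEST FRAMING. Lean index of the computation cell `pub-hsemireg`, widening group ENGINE-W (code A, seat `engine-w-1`, gen 18).
RING IDENTITIES IN A COMMUTATIVE STAR-RING ONLY (denominators cleared), plus two integer certificates in `ℤ√10`, `ℤ√15`. What is NOT formalised:
that `M := √m·diag(1∕c₅, 1∕c₆)·P` is INTEGRAL on the seed lattice and conjugates `𝒥_s ⊕ 𝒥_s` into `𝒥′_{c₅} ⊕ 𝒥′_{c₆}` (uses `I_c = (√m∕c)𝔞_c·I_s`
and the h-ratio law — lattice bookkeeping), ideals, class groups, or anything object-level; nothing here says that HC, HC_CM or HC_AV holds.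
Theorems only (0 `def`, 0 named fact, 0 `sorry`). New namespace `PairTransport`. Companion: `AntiUnitaryPairMatrix.lean` (#8, the special case
`𝔞₅ = 𝔞₆ = R`, `U_m = [[x, −ȳ],[y, x̄]]`).

SOURCE (the cell's own result, by value): `widen/ENGINE-W/out/probe5/PROBE5-STIZ-A.md` §19 «CONSTRUCTION (pairs, any h). Target with t = 1 (N = A² − m),
weights c₅, c₆, 𝔞_i = (c_i, A+√m) regular, and 𝔞₅𝔞₆ = (β) principal with N(β) = +c₅c₆. Pick a «unit vector» v = (p,q) ∈ 𝔞₅ ⊕ 𝔞₆ with c₆N(p) + c₅N(q) = c₅c₆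
and put w := (c₅·q̄∕β̄, −c₆·p̄∕β̄) ∈ 𝔞₅ ⊕ 𝔞₆, P := [v w]: then P*·diag(1∕c₅,1∕c₆)·P = I, det P = −β … ⟨w,v⟩ = 0 and ⟨w,w⟩ = N(1∕β̄)(c₅N(q) + c₆N(p)) = 1».
With `D = diag(1∕c₅, 1∕c₆)` and `⟨x, y⟩_D := x̄₁y₁∕c₅ + x̄₂y₂∕c₆`, the three entries of `P*DP = 1` are `⟨v,v⟩_D = 1` (the hypothesis), `⟨v,w⟩_D = 0`,
`⟨w,w⟩_D = 1`; multiplied by `c₅c₆` (and by `β̄` resp. `ββ̄` to clear `w`'s denominator) they are the ring identities below.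

* `orth_mul_star` — `(c₆ p̄ w₁ + c₅ q̄ w₂)·β̄ = 0` whenever `w₁β̄ = c₅q̄`, `w₂β̄ = −c₆p̄` (any commutative star-ring; no hypothesis on `v`).
* `ww_mul_norm` — `(c₆ w₁w̄₁ + c₅ w₂w̄₂)·(ββ̄) = c₅c₆·(c₆ pp̄ + c₅ qq̄)` whenever additionally `c₅, c₆` are self-adjoint (`star c = c`).
* `det_mul_star` — `(p w₂ − q w₁)·β̄ = −(c₆ pp̄ + c₅ qq̄)`.
* `pair_matrix` — in a star-DOMAIN with `β̄ ≠ 0`: from `c₆ pp̄ + c₅ qq̄ = c₅c₆` and `ββ̄ = c₅c₆`: `⟨v,w⟩ = 0`, `c₆ w₁w̄₁ + c₅ w₂w̄₂ = c₅c₆`, `det P = −β`.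
* certificates (integers of `ℚ(√10)`, `ℚ(√15)`; `decide`): ℚ(√10), target (A, N) = (4, 6), weights (2, 3), `β = 4 + √10` (`𝔭₂𝔮₃ = (4+√10)`):
  `v = (6 + 2√10, 3)`, `w = (4 + √10, −2 + √10)`; ℚ(√15), target (15, 210), weights (2, 5), `β = 5 + √15`: `v = (1 + √15, 10 + 2√15)`, `w = (4, 5 + 2√15)`
  — in both: `c₆N(p) + c₅N(q) = c₅c₆`, `w_iβ̄` as displayed, `⟨v,w⟩ = 0`, `c₆N(w₁) + c₅N(w₂) = c₅c₆`, `det P = −β` (so these two criterion-allowed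
  cells of the §19 census carry explicit D-unitary `P`; the witnesses are this file's, found by hand, not read from `construct2_batch.A.json`).
-/

namespace Summit.Ventures.HSemireg.PairTransport

section general

variable {R : Type*} [CommRing R] [StarRing R]

/-- **Orthogonality, denominator cleared**: if `w₁·β̄ = c₅·q̄` and `w₂·β̄ = −c₆·p̄` then `(c₆ p̄ w₁ + c₅ q̄ w₂)·β̄ = 0`. [kernel, `ring`] -/
theorem orth_mul_star (c₅ c₆ p q w₁ w₂ β : R) (hw₁ : w₁ * star β = c₅ * star q) (hw₂ : w₂ * star β = -(c₆ * star p)) :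
    (c₆ * star p * w₁ + c₅ * star q * w₂) * star β = 0 := by
  have e : (c₆ * star p * w₁ + c₅ * star q * w₂) * star β
      = c₆ * star p * (w₁ * star β) + c₅ * star q * (w₂ * star β) := by ring
  rw [e, hw₁, hw₂]
  ring

/-- The conjugate relations: `β·w̄₁ = q·c₅` and `β·w̄₂ = −(p·c₆)` (apply `star`; `c₅, c₆` self-adjoint). [kernel] -/
theorem star_relations (c₅ c₆ p q w₁ w₂ β : R) (hc₅ : star c₅ = c₅) (hc₆ : star c₆ = c₆)
    (hw₁ : w₁ * star β = c₅ * star q) (hw₂ : w₂ * star β = -(c₆ * star p)) :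
    β * star w₁ = q * c₅ ∧ β * star w₂ = -(p * c₆) := by
  constructor
  · have h := congrArg star hw₁
    simp only [star_mul, star_star, hc₅] at h
    exact h
  · have h := congrArg star hw₂
    simp only [star_mul, star_neg, star_star, hc₆] at h
    exact h

/-- **`⟨w, w⟩`, denominators cleared**: `(c₆ w₁w̄₁ + c₅ w₂w̄₂)·(ββ̄) = c₅c₆·(c₆ pp̄ + c₅ qq̄)`. [kernel, `ring` after substitution] -/
theorem ww_mul_norm (c₅ c₆ p q w₁ w₂ β : R) (hc₅ : star c₅ = c₅) (hc₆ : star c₆ = c₆)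
    (hw₁ : w₁ * star β = c₅ * star q) (hw₂ : w₂ * star β = -(c₆ * star p)) :
    (c₆ * (w₁ * star w₁) + c₅ * (w₂ * star w₂)) * (β * star β)
      = c₅ * c₆ * (c₆ * (p * star p) + c₅ * (q * star q)) := by
  obtain ⟨h₁, h₂⟩ := star_relations c₅ c₆ p q w₁ w₂ β hc₅ hc₆ hw₁ hw₂
  have e : (c₆ * (w₁ * star w₁) + c₅ * (w₂ * star w₂)) * (β * star β)
      = c₆ * ((w₁ * star β) * (β * star w₁)) + c₅ * ((w₂ * star β) * (β * star w₂)) := by ring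
  rw [e, hw₁, h₁, hw₂, h₂]
  ring

/-- **`det P`, denominator cleared**: `(p w₂ − q w₁)·β̄ = −(c₆ pp̄ + c₅ qq̄)`. [kernel, `ring`] -/
theorem det_mul_star (c₅ c₆ p q w₁ w₂ β : R) (hw₁ : w₁ * star β = c₅ * star q) (hw₂ : w₂ * star β = -(c₆ * star p)) :
    (p * w₂ - q * w₁) * star β = -(c₆ * (p * star p) + c₅ * (q * star q)) := by
  have e : (p * w₂ - q * w₁) * star β = p * (w₂ * star β) - q * (w₁ * star β) := by ring
  rw [e, hw₁, hw₂]
  ring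

end general

section domain

variable {R : Type*} [CommRing R] [StarRing R] [IsDomain R]

/-- **THE PAIR MATRIX `P = [v w]` (PROBE5 §19)**: in a commutative star-domain, with `c₅, c₆` self-adjoint, `ββ̄ = c₅c₆`, `β̄ ≠ 0`, a unit vector
`c₆ pp̄ + c₅ qq̄ = c₅c₆`, and `w` defined by `w₁β̄ = c₅q̄`, `w₂β̄ = −c₆p̄`: the columns are D-orthogonal (`c₆ p̄w₁ + c₅ q̄w₂ = 0`), `w` is a unit
vector (`c₆ w₁w̄₁ + c₅ w₂w̄₂ = c₅c₆`), and `det P = p w₂ − q w₁ = −β`. [kernel] -/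
theorem pair_matrix (c₅ c₆ p q w₁ w₂ β : R) (hc₅ : star c₅ = c₅) (hc₆ : star c₆ = c₆) (hβ : β * star β = c₅ * c₆)
    (hβ0 : star β ≠ 0) (hv : c₆ * (p * star p) + c₅ * (q * star q) = c₅ * c₆)
    (hw₁ : w₁ * star β = c₅ * star q) (hw₂ : w₂ * star β = -(c₆ * star p)) :
    c₆ * star p * w₁ + c₅ * star q * w₂ = 0 ∧ c₆ * (w₁ * star w₁) + c₅ * (w₂ * star w₂) = c₅ * c₆ ∧ p * w₂ - q * w₁ = -β := by
  refine ⟨?_, ?_, ?_⟩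
  · have h := orth_mul_star c₅ c₆ p q w₁ w₂ β hw₁ hw₂
    rcases mul_eq_zero.mp h with h0 | h0
    · exact h0
    · exact absurd h0 hβ0
  · have h := ww_mul_norm c₅ c₆ p q w₁ w₂ β hc₅ hc₆ hw₁ hw₂
    rw [hv] at h
    rw [← hβ] at h ⊢
    have hββ : β * star β ≠ 0 := mul_ne_zero (fun h0 => hβ0 (by rw [h0, star_zero])) hβ0
    exact mul_right_cancel₀ hββ h
  · have h := det_mul_star c₅ c₆ p q w₁ w₂ β hw₁ hw₂
    rw [hv, ← hβ] at h
    have h' : (p * w₂ - q * w₁ + β) * star β = 0 := by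
      have e : (p * w₂ - q * w₁ + β) * star β = (p * w₂ - q * w₁) * star β + β * star β := by ring
      rw [e, h]
      ring
    rcases mul_eq_zero.mp h' with h0 | h0
    · exact eq_neg_of_add_eq_zero_left h0
    · exact absurd h0 hβ0

end domain

/-! ## Certificates in `ℤ√10` and `ℤ√15` (conjugates written out: `p̄ = ⟨p.re, −p.im⟩`) -/

/-- **ℚ(√10), target (4, 6), weights (c₅, c₆) = (2, 3), β = 4 + √10**: `v = (p, q) = (6 + 2√10, 3)`, `w = (4 + √10, −2 + √10)`:
unit vector `3·N(p) + 2·N(q) = 3·(−4) + 2·9 = 6`; `w₁β̄ = 2q̄`, `w₂β̄ = −3p̄`; `⟨v,w⟩`: `3 p̄ w₁ + 2 q̄ w₂ = 0`; `3·N(w₁) + 2·N(w₂) = 18 − 12 = 6`;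
`det P = p w₂ − q w₁ = −β`; and `ββ̄ = 6`. [kernel, `decide`] -/
theorem certificate_sqrt10 :
    (3 : ℤ√10) * (⟨6, 2⟩ * ⟨6, -2⟩) + 2 * (⟨3, 0⟩ * ⟨3, 0⟩) = 6 ∧
    (⟨4, 1⟩ : ℤ√10) * ⟨4, -1⟩ = 2 * ⟨3, 0⟩ ∧ (⟨-2, 1⟩ : ℤ√10) * ⟨4, -1⟩ = -(3 * ⟨6, -2⟩) ∧
    (3 : ℤ√10) * ⟨6, -2⟩ * ⟨4, 1⟩ + 2 * ⟨3, 0⟩ * ⟨-2, 1⟩ = 0 ∧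
    (3 : ℤ√10) * (⟨4, 1⟩ * ⟨4, -1⟩) + 2 * (⟨-2, 1⟩ * ⟨-2, -1⟩) = 6 ∧
    (⟨6, 2⟩ : ℤ√10) * ⟨-2, 1⟩ - ⟨3, 0⟩ * ⟨4, 1⟩ = -⟨4, 1⟩ ∧ (⟨4, 1⟩ : ℤ√10) * ⟨4, -1⟩ = 6 := by
  decide

/-- **ℚ(√15), target (15, 210), weights (c₅, c₆) = (2, 5), β = 5 + √15**: `v = (1 + √15, 10 + 2√15)`, `w = (4, 5 + 2√15)`:
`5·N(p) + 2·N(q) = 5·(−14) + 2·40 = 10`; `w₁β̄ = 2q̄`, `w₂β̄ = −5p̄`; `5 p̄ w₁ + 2 q̄ w₂ = 0`; `5·N(w₁) + 2·N(w₂) = 80 − 70 = 10`;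
`det P = −β`; `ββ̄ = 10`. [kernel, `decide`] -/
theorem certificate_sqrt15 :
    (5 : ℤ√15) * (⟨1, 1⟩ * ⟨1, -1⟩) + 2 * (⟨10, 2⟩ * ⟨10, -2⟩) = 10 ∧
    (⟨4, 0⟩ : ℤ√15) * ⟨5, -1⟩ = 2 * ⟨10, -2⟩ ∧ (⟨5, 2⟩ : ℤ√15) * ⟨5, -1⟩ = -(5 * ⟨1, -1⟩) ∧
    (5 : ℤ√15) * ⟨1, -1⟩ * ⟨4, 0⟩ + 2 * ⟨10, -2⟩ * ⟨5, 2⟩ = 0 ∧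
    (5 : ℤ√15) * (⟨4, 0⟩ * ⟨4, 0⟩) + 2 * (⟨5, 2⟩ * ⟨5, -2⟩) = 10 ∧
    (⟨1, 1⟩ : ℤ√15) * ⟨5, 2⟩ - ⟨10, 2⟩ * ⟨4, 0⟩ = -⟨5, 1⟩ ∧ (⟨5, 1⟩ : ℤ√15) * ⟨5, -1⟩ = 10 := by
  decide

/-- The conjugates used above ARE `star`: `star ⟨x, y⟩ = ⟨x, −y⟩` in `ℤ√d` (Mathlib), e.g. for `p = 6 + 2√10` and `β = 5 + √15`. [kernel] -/
theorem star_examples : star (⟨6, 2⟩ : ℤ√10) = ⟨6, -2⟩ ∧ star (⟨5, 1⟩ : ℤ√15) = ⟨5, -1⟩ := by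
  constructor <;> decide

end Summit.Ventures.HSemireg.PairTransport
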